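import Literature.NumberTheory.LFunctions.Zhang2022.RepairSection18Boxes
import Literature.NumberTheory.LFunctions.Zhang2022.RepairSection18Closed
import Literature.NumberTheory.LFunctions.Zhang2022.RepairSection9Boxes
import Literature.NumberTheory.LFunctions.Zhang2022.RepairFrakc12Theta
import Literature.NumberTheory.LFunctions.Zhang2022.RepairAdmissible

/-!
# Zhang (2022) §18-margin repair rung, LOCAL ANNEX K0: the TIE FAMILY of record and the transfer
# `QMOf(entries(θ), m) ⪰ 0 ⇒ m ≤ C₂₃₂(θ, ι) ∀ι` at rational tie points (box tables for kernel leaves)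

Trunk T-ANT (NumberTheory/LFunctions). Y. Zhang, *Discrete mean estimates and the Landau–Siegel
zero*, arXiv:2211.02515v1 (2022) [Zhang2022LandauSiegel] — **an unrefereed manuscript under
adjudication; nothing here asserts or denies its Theorems 1–2 or any analytic lemma; no claim about
Landau–Siegel zeros is made.** Rung F-S1R (D-0077), ANNEX K-N slot [Q2-9] "K0 point certificates"
(ASSIGNMENTS v2; REPAIR-LEDGER §points), seat repair-p6. Companion `RepairTiePointsCert` carries the
literal tables and the kernel certificates at P1–P3.

The TIE FAMILY of record (REPAIR-LEDGER §points P1–P3; tie dictionary PARAMS v2):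
`θ_tie(ν₁; ι) = (ν₁, ½, ¾ − ν₁/2; 3/2, 5/2, 3/2; ι₂, ι₃, ι₄; ½)` (`thetaTie`; `θ_tie(0.504; ι) = thetaIota ι`,
`thetaTie_printed`; admissible for `½ < ν₁ < 1`, `admissible_thetaTie`). For the rung's reduced §18
functionals `Repair.C232D θ` (derived `c₃₄` prefactor, `= C232T θ (frakc1T θ) (frakc2T θ)`) and
`Repair.C232P θ` (printed prefactor continued as `ν₂/ν₁`, `frakc2PT`) the `ι`-directions are eliminated
EXACTLY: the functional is the Hermitian form of `RepairFormMatrix.QMOf` with entries `cDiagR/cCrossR`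
(`RepairFrakc12Theta`, §§8–9; `frakc1T_eq_entries`, `frakc2T_eq_entries`, `frakc2PT_eq_entries`) and p1's
`F··T` (`RepairSection18Forms`, §18) — `QD θ m`, `QPm θ m` — and `QMOf(…, m) ⪰ 0 ⇒ m ≤ C232(θ)`
for the `ι` inside `θ` (`C232D_ge_of_QD_posSemidef`, `C232P_ge_of_QPm_posSemidef`, via
`RepairSection18Closed.QP_eq_QMOf` + p1's `C232T_ge_of_posSemidef`); since the entries do not see `ι`, one
PSD certificate serves every `ι`. At a RATIONAL tie point `q` the box tables `tieBoxD q m` / `tieBoxP q m`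
(p5's `cDiagBL/cCrossBL` + p6's `F··TB` of `RepairSection18Boxes` at point intervals `tieV1/2/3`) enclose
`QD/QPm` entrywise (`mem_tieBoxD/P`, flags `tieOK`), so an accepted leaf `cmatEncl lit (tieBox q m) ∧
hermPsdCheck lit V` gives `m ≤ C232D (thetaTie q ι)` for all `ι` (`C232D_tie_ge_of_cert`,
`C232P_tie_ge_of_cert`). Transcription reading: reduced `𝔠₃`, Zhang's linearised (12.13) windows
(`I6T/I7T`), i.e. lineage C's «integral-r». Pure bookkeeping; no new `Prop` facts.

## References

* Y. Zhang, arXiv:2211.02515v1 (2022), §2 (2.21)–(2.26), (2.32), §8 (8.19)–(8.23), §9 (9.3)–(9.7),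
  §12 (12.13)–(12.15), Lemma 15.1, (17.4), §18 (18.1)–(18.2). [cite: Zhang2022LandauSiegel, §§2, 8, 9, 12, 15, 17, 18]
* S. M. Rump, *Verification of positive definiteness*, BIT 46 (2006) 433–452. [Rump2006]
* R. E. Moore, *Interval Analysis* (1966), Theorem 3.1, §4.4. [Moore1966]
-/

noncomputable section

open Complex Real ComplexConjugate Matrix
open scoped ComplexOrder
open Literature.Analysis.ValidatedNumerics.Numerics
open Literature.Analysis.ValidatedNumerics.IntervalGershgorin

namespace Literature.NumberTheory.LFunctions.Zhang2022

namespace Repair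

/-! ### The tie family and its admissibility -/

/-- **the tie family of record**: `θ_tie(ν₁; ι) = (ν₁, ½, ¾ − ν₁/2; 3/2, 5/2, 3/2; ι₂, ι₃, ι₄; ½)`
(REPAIR-LEDGER §points: `ν₂ = ½ = cut₁`, `ν₃ = ¾ − ν₁/2`, printed shifts).
[cite: Zhang2022LandauSiegel, §2 (2.21)–(2.26)] -/
def thetaTie (ν1 : ℝ) (w2 w3 w4 : ℂ) : Theta where
  nu1 := ν1
  nu2 := 1 / 2
  nu3 := 3 / 4 - ν1 / 2
  k1 := 3 / 2
  k2 := 5 / 2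
  k3 := 3 / 2
  iota2 := w2
  iota3 := w3
  iota4 := w4
  cut1 := 1 / 2

/-- at `ν₁ = 0.504` the tie family is the printed `ι`-family. [cite: Zhang2022LandauSiegel, §2 (2.21)–(2.26)] -/
theorem thetaTie_printed (w2 w3 w4 : ℂ) : thetaTie 0.504 w2 w3 w4 = thetaIota w2 w3 w4 := by
  simp only [thetaTie, thetaIota]; norm_num

/-- the tie family is admissible for `½ < ν₁ < 1` (`Repair.AdmissibleTheta`: `ν₃ < ν₂ ≤ ½ < ν₁ < 1`,
`ν₁ + ν₃ = ¾ + ν₁/2 > 1`, `cut₁ = ½`, shifts in `(0,5)`, `k₁ = k₃`). [cite: Zhang2022LandauSiegel, §§2, 7–9, 12, 14, 15] -/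
theorem admissible_thetaTie {ν1 : ℝ} (hlo : 1 / 2 < ν1) (hhi : ν1 < 1) (w2 w3 w4 : ℂ) :
    AdmissibleTheta (thetaTie ν1 w2 w3 w4) := by
  refine ⟨⟨?_, ?_⟩, ⟨?_, ?_, ?_⟩, ?_, ?_, ?_, ⟨⟨?_, ?_⟩, ⟨?_, ?_⟩, ⟨?_, ?_⟩⟩, ?_⟩ <;>
    simp only [thetaTie, Theta.belowP, Theta.dualRangesNonempty, Theta.cutAtHalf, Theta.tiedOuterShifts] <;>
    linarith

/-! ### The reduced §18 matrix at `θ` and the transfer `PSD ⇒ floor ∀ι` -/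

/-- the matrix of the reduced §18 form at `θ`, DERIVED `c₃₄` prefactor: `QMOf` with the `§8/§9` entries
`cDiag/cCross` of `θ` and p1's `F··T θ`. [cite: Zhang2022LandauSiegel, (2.32), (8.23), (9.7), (18.1)] -/
def QD (θ : Theta) (m : ℚ) : Matrix (Fin 4) (Fin 4) ℂ :=
  QMOf (cDiagR θ.k1 θ.nu1) (conj (cCrossR θ.k1 θ.k2 θ.nu1 θ.nu2)) (cCrossR θ.k1 θ.k2 θ.nu1 θ.nu2)
    (cDiagR θ.k2 θ.nu2) (cDiagR θ.k3 θ.nu3) (cCrossR θ.k2 θ.k3 θ.nu2 θ.nu3)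
    (F20T θ) (F21T θ) (F30T θ) (F31T θ) m

/-- the same with the PRINTED `c₃₄` prefactor continued as `ν₂/ν₁` (`frakc2PT`). [cite: Zhang2022LandauSiegel, (9.5)–(9.7)] -/
def QPm (θ : Theta) (m : ℚ) : Matrix (Fin 4) (Fin 4) ℂ :=
  QMOf (cDiagR θ.k1 θ.nu1) (conj (cCrossR θ.k1 θ.k2 θ.nu1 θ.nu2)) (cCrossR θ.k1 θ.k2 θ.nu1 θ.nu2)
    (cDiagR θ.k2 θ.nu2) (cDiagR θ.k3 θ.nu3) (((θ.nu2 / θ.nu1 : ℝ) : ℂ) * cCrossR θ.k2 θ.k3 θ.nu2 θ.nu3)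
    (F20T θ) (F21T θ) (F30T θ) (F31T θ) m

/-- `𝔠₁(θ)` is the `§8` block of the entries. [cite: Zhang2022LandauSiegel, (8.23)] -/
theorem frakc1T_eq_entries (θ : Theta) : frakc1T θ
    = cDiagR θ.k1 θ.nu1 + θ.iota2 * conj (cCrossR θ.k1 θ.k2 θ.nu1 θ.nu2)
      + conj θ.iota2 * cCrossR θ.k1 θ.k2 θ.nu1 θ.nu2 + (Complex.normSq θ.iota2 : ℂ) * cDiagR θ.k2 θ.nu2 := by
  unfold frakc1T pairFormR
  simp only [map_one, Complex.ofReal_one, one_mul]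
  ring

/-- `𝔠₂(θ)` (derived prefactor) is the `§9` block of the entries (`c₄₄ = c₂₂`). [cite: Zhang2022LandauSiegel, (9.7)] -/
theorem frakc2T_eq_entries (θ : Theta) : frakc2T θ
    = (Complex.normSq θ.iota3 : ℂ) * cDiagR θ.k3 θ.nu3 + θ.iota3 * conj θ.iota4 * cCrossR θ.k2 θ.k3 θ.nu2 θ.nu3
      + θ.iota4 * conj θ.iota3 * conj (cCrossR θ.k2 θ.k3 θ.nu2 θ.nu3)
      + (Complex.normSq θ.iota4 : ℂ) * cDiagR θ.k2 θ.nu2 := by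
  unfold frakc2T pairFormR
  simp only [Complex.conj_conj, Complex.normSq_conj]
  ring

/-- `𝔠₂(θ)` (printed prefactor) is the `§9` block with `c₃₄ ↦ (ν₂/ν₁)c₃₄`. [cite: Zhang2022LandauSiegel, (9.5)–(9.7)] -/
theorem frakc2PT_eq_entries (θ : Theta) : frakc2PT θ
    = (Complex.normSq θ.iota3 : ℂ) * cDiagR θ.k3 θ.nu3
      + θ.iota3 * conj θ.iota4 * (((θ.nu2 / θ.nu1 : ℝ) : ℂ) * cCrossR θ.k2 θ.k3 θ.nu2 θ.nu3)
      + θ.iota4 * conj θ.iota3 * conj (((θ.nu2 / θ.nu1 : ℝ) : ℂ) * cCrossR θ.k2 θ.k3 θ.nu2 θ.nu3)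
      + (Complex.normSq θ.iota4 : ℂ) * cDiagR θ.k2 θ.nu2 := by
  unfold frakc2PT
  simp only [Complex.conj_conj, Complex.normSq_conj]
  ring

/-- **`QD θ m ⪰ 0 ⇒ m ≤ C232D θ`** (the point's `ι` is `θ`'s own; the entries do not see `ι`, so one
certificate serves every `ι`). [cite: Zhang2022LandauSiegel, (2.32)] -/
theorem C232D_ge_of_QD_posSemidef (θ : Theta) {m : ℚ} (h : (QD θ m).PosSemidef) : (m : ℝ) ≤ C232D θ := by
  unfold QD at h
  rw [← QP_eq_QMOf] at h
  exact C232T_ge_of_posSemidef θ (frakc1T_eq_entries θ) (frakc2T_eq_entries θ) h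

/-- **`QPm θ m ⪰ 0 ⇒ m ≤ C232P θ`**. [cite: Zhang2022LandauSiegel, (2.32)] -/
theorem C232P_ge_of_QPm_posSemidef (θ : Theta) {m : ℚ} (h : (QPm θ m).PosSemidef) : (m : ℝ) ≤ C232P θ := by
  unfold QPm at h
  rw [← QP_eq_QMOf] at h
  exact C232T_ge_of_posSemidef θ (frakc1T_eq_entries θ) (frakc2PT_eq_entries θ) h

/-- `QD`, `QPm` are Hermitian (diagonal entries `b + b̄` real). [cite: Zhang2022LandauSiegel, (2.32)] -/
theorem QD_conjTranspose (θ : Theta) (m : ℚ) : (QD θ m)ᴴ = QD θ m ∧ (QPm θ m)ᴴ = QPm θ m := by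
  have hd : ∀ k ν, conj (cDiagR k ν) = cDiagR k ν := fun k ν => by
    unfold cDiagR; simp only [map_add, Complex.conj_conj]; ring
  constructor <;> ext i j <;> fin_cases i <;> fin_cases j <;>
    simp [QD, QPm, QMOf, Matrix.conjTranspose_apply, hd, Complex.conj_ofReal]

/-! ### Box tables at a rational tie point -/

/-- point intervals of the tie coordinates `(ν₁, ½, ¾ − ν₁/2)`. [cite: Zhang2022LandauSiegel, §2 (2.21)] -/
def tieV1 (q : ℚ) : FI := FI.ofRat q
/-- [cite: Zhang2022LandauSiegel, §2 (2.21)] -/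
def tieV2 : FI := FI.ofRat (1 / 2)
/-- [cite: Zhang2022LandauSiegel, §2 (2.21)] -/
def tieV3 (q : ℚ) : FI := FI.ofRat (3 / 4 - q / 2)

/-- box table of `QD (θ_tie q ι) m`. [cite: Zhang2022LandauSiegel, (2.32)] -/
def tieBoxD (q m : ℚ) : CMat 4 :=
  QBoxOf (cDiagBL (3/2) (tieV1 q)) (cCrossBL (3/2) (5/2) (tieV1 q) tieV2).conj
    (cCrossBL (3/2) (5/2) (tieV1 q) tieV2) (cDiagBL (5/2) tieV2) (cDiagBL (3/2) (tieV3 q))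
    (cCrossBL (5/2) (3/2) tieV2 (tieV3 q)) (F20TB (3/2) (3/2) (tieV1 q) (tieV3 q))
    (F21TB (5/2) (3/2) tieV2 (tieV3 q)) (F30TB (3/2) (5/2) (tieV1 q) tieV2) (F31TB (5/2) tieV2) m

/-- box table of `QPm (θ_tie q ι) m` (`c₃₄` box scaled by the interval of `ν₂/ν₁`). [cite: Zhang2022LandauSiegel, (2.32), (9.5)–(9.6)] -/
def tieBoxP (q m : ℚ) : CMat 4 :=
  QBoxOf (cDiagBL (3/2) (tieV1 q)) (cCrossBL (3/2) (5/2) (tieV1 q) tieV2).conj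
    (cCrossBL (3/2) (5/2) (tieV1 q) tieV2) (cDiagBL (5/2) tieV2) (cDiagBL (3/2) (tieV3 q))
    ((cCrossBL (5/2) (3/2) tieV2 (tieV3 q)).mulFI (tieV2.mul (recipFI (tieV1 q))))
    (F20TB (3/2) (3/2) (tieV1 q) (tieV3 q))
    (F21TB (5/2) (3/2) tieV2 (tieV3 q)) (F30TB (3/2) (5/2) (tieV1 q) tieV2) (F31TB (5/2) tieV2) m

/-- validity flags of all entry boxes at the tie point `q`. [folklore] -/
def tieOK (q : ℚ) : Bool :=
  bDiagOK (3/2) (tieV1 q) && bDiagOK (5/2) tieV2 && bDiagOK (3/2) (tieV3 q)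
    && cCrossOK (3/2) (5/2) (tieV1 q) tieV2 && cCrossOK (5/2) (3/2) tieV2 (tieV3 q)
    && slice18OK (3/2) (5/2) (3/2) (tieV1 q) tieV2 (tieV3 q) && recipOK (tieV1 q)

/-- the slice hypotheses at a rational tie point. [cite: Moore1966, Theorem 3.1] -/
theorem sliceHyp_thetaTie {q : ℚ} (hq : (q : ℝ) ≠ 0) (hq3 : (3 / 4 - q / 2 : ℚ) ≠ 0)
    (hok : slice18OK (3/2) (5/2) (3/2) (tieV1 q) tieV2 (tieV3 q) = true) (w2 w3 w4 : ℂ) :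
    SliceHyp (thetaTie q w2 w3 w4) (3/2) (5/2) (3/2) (tieV1 q) tieV2 (tieV3 q) where
  h1 := by simp only [thetaTie]; exact FI.mem_ofRat q
  h2 := by simp only [thetaTie]; unfold tieV2; convert FI.mem_ofRat (1/2 : ℚ) using 1; norm_num
  h3 := by
    simp only [thetaTie]; unfold tieV3; convert FI.mem_ofRat (3/4 - q/2 : ℚ) using 1; push_cast; ring
  n1 := by simp only [thetaTie]; exact hq
  n2 := by simp only [thetaTie]; norm_num
  n3 := by
    simp only [thetaTie]
    have : ((3 / 4 - q / 2 : ℚ) : ℝ) = 3 / 4 - (q : ℝ) / 2 := by push_cast; ring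
    rw [← this]; exact_mod_cast hq3
  hk1 := by simp only [thetaTie]; norm_num
  hk2 := by simp only [thetaTie]; norm_num
  hk3 := by simp only [thetaTie]; norm_num
  k1ne := by norm_num
  k2ne := by norm_num
  k3ne := by norm_num
  ok := hok

/-- **entrywise enclosure at a rational tie point**, derived prefactor. [cite: Moore1966, Theorem 3.1] -/
theorem mem_tieBoxD {q : ℚ} (hq : (q : ℝ) ≠ 0) (hq3 : (3 / 4 - q / 2 : ℚ) ≠ 0) (hok : tieOK q = true)
    (w2 w3 w4 : ℂ) (m : ℚ) : CMMem (QD (thetaTie q w2 w3 w4) m) (tieBoxD q m) := by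
  simp only [tieOK, Bool.and_eq_true] at hok
  obtain ⟨⟨⟨⟨⟨⟨ok1, ok2⟩, ok3⟩, ok12⟩, ok23⟩, oks⟩, _⟩ := hok
  have H := sliceHyp_thetaTie hq hq3 oks w2 w3 w4
  have e3 : ((3 / 4 - q / 2 : ℚ) : ℝ) = 3 / 4 - (q : ℝ) / 2 := by push_cast; ring
  have hν1 : FI.mem (thetaTie (q : ℝ) w2 w3 w4).nu1 (tieV1 q) := H.h1
  have hν2 : FI.mem (thetaTie (q : ℝ) w2 w3 w4).nu2 tieV2 := H.h2
  have hν3 : FI.mem (thetaTie (q : ℝ) w2 w3 w4).nu3 (tieV3 q) := H.h3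
  have k1 : (thetaTie (q : ℝ) w2 w3 w4).k1 = ((3/2 : ℚ) : ℝ) := H.hk1
  have k2 : (thetaTie (q : ℝ) w2 w3 w4).k2 = ((5/2 : ℚ) : ℝ) := H.hk2
  have k3 : (thetaTie (q : ℝ) w2 w3 w4).k3 = ((3/2 : ℚ) : ℝ) := H.hk3
  unfold QD tieBoxD
  rw [k1, k2, k3, cDiagR_ratCast, cDiagR_ratCast, cDiagR_ratCast, cCrossR_ratCast, cCrossR_ratCast]
  exact mem_QBoxOf (mem_cDiagBL (by norm_num) hν1 ok1)
    (CB.mem_conj (mem_cCrossBL (by norm_num) (by norm_num) (by norm_num) hν1 hν2 ok12))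
    (mem_cCrossBL (by norm_num) (by norm_num) (by norm_num) hν1 hν2 ok12) (mem_cDiagBL (by norm_num) hν2 ok2)
    (mem_cDiagBL (by norm_num) hν3 ok3) (mem_cCrossBL (by norm_num) (by norm_num) (by norm_num) hν2 hν3 ok23)
    H.mem_F20T H.mem_F21T H.mem_F30T H.mem_F31T m

/-- **entrywise enclosure at a rational tie point**, printed prefactor. [cite: Moore1966, Theorem 3.1] -/
theorem mem_tieBoxP {q : ℚ} (hq : (q : ℝ) ≠ 0) (hq3 : (3 / 4 - q / 2 : ℚ) ≠ 0) (hok : tieOK q = true)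
    (w2 w3 w4 : ℂ) (m : ℚ) : CMMem (QPm (thetaTie q w2 w3 w4) m) (tieBoxP q m) := by
  simp only [tieOK, Bool.and_eq_true] at hok
  obtain ⟨⟨⟨⟨⟨⟨ok1, ok2⟩, ok3⟩, ok12⟩, ok23⟩, oks⟩, okr⟩ := hok
  have H := sliceHyp_thetaTie hq hq3 oks w2 w3 w4
  have hν1 : FI.mem (thetaTie (q : ℝ) w2 w3 w4).nu1 (tieV1 q) := H.h1
  have hν2 : FI.mem (thetaTie (q : ℝ) w2 w3 w4).nu2 tieV2 := H.h2
  have hν3 : FI.mem (thetaTie (q : ℝ) w2 w3 w4).nu3 (tieV3 q) := H.h3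
  have k1 : (thetaTie (q : ℝ) w2 w3 w4).k1 = ((3/2 : ℚ) : ℝ) := H.hk1
  have k2 : (thetaTie (q : ℝ) w2 w3 w4).k2 = ((5/2 : ℚ) : ℝ) := H.hk2
  have k3 : (thetaTie (q : ℝ) w2 w3 w4).k3 = ((3/2 : ℚ) : ℝ) := H.hk3
  have hr : FI.mem ((thetaTie (q : ℝ) w2 w3 w4).nu2 / (thetaTie (q : ℝ) w2 w3 w4).nu1)
      (tieV2.mul (recipFI (tieV1 q))) := by
    rw [div_eq_mul_one_div]; exact FI.mem_mul hν2 (mem_recipFI okr hν1)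
  unfold QPm tieBoxP
  rw [k1, k2, k3, cDiagR_ratCast, cDiagR_ratCast, cDiagR_ratCast, cCrossR_ratCast, cCrossR_ratCast]
  exact mem_QBoxOf (mem_cDiagBL (by norm_num) hν1 ok1)
    (CB.mem_conj (mem_cCrossBL (by norm_num) (by norm_num) (by norm_num) hν1 hν2 ok12))
    (mem_cCrossBL (by norm_num) (by norm_num) (by norm_num) hν1 hν2 ok12) (mem_cDiagBL (by norm_num) hν2 ok2)
    (mem_cDiagBL (by norm_num) hν3 ok3)
    (by rw [mul_comm]; exact CB.mem_mulFI (mem_cCrossBL (by norm_num) (by norm_num) (by norm_num) hν2 hν3 ok23) hr)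
    H.mem_F20T H.mem_F21T H.mem_F30T H.mem_F31T m

/-- **from an accepted leaf to the floor for every `ι`** at a rational tie point. [cite: Rump2006, §1] -/
theorem C232D_tie_ge_of_cert {q m : ℚ} (hq : (q : ℝ) ≠ 0) (hq3 : (3 / 4 - q / 2 : ℚ) ≠ 0)
    (hok : tieOK q = true) {lit : CMat 4} {V : Fin (4 + 4) → Fin (4 + 4) → ℤ}
    (hcert : cmatEncl lit (tieBoxD q m) = true ∧ hermPsdCheck lit V = true) (w2 w3 w4 : ℂ) :
    (m : ℝ) ≤ C232D (thetaTie q w2 w3 w4) :=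
  C232D_ge_of_QD_posSemidef _ (posSemidef_of_hermPsdCheck hcert.2
    (cmmem_of_cmatEncl hcert.1 (mem_tieBoxD hq hq3 hok w2 w3 w4 m)) (QD_conjTranspose _ _).1)

/-- the same for the printed-prefactor functional `C232P`. [cite: Rump2006, §1] -/
theorem C232P_tie_ge_of_cert {q m : ℚ} (hq : (q : ℝ) ≠ 0) (hq3 : (3 / 4 - q / 2 : ℚ) ≠ 0)
    (hok : tieOK q = true) {lit : CMat 4} {V : Fin (4 + 4) → Fin (4 + 4) → ℤ}
    (hcert : cmatEncl lit (tieBoxP q m) = true ∧ hermPsdCheck lit V = true) (w2 w3 w4 : ℂ) :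
    (m : ℝ) ≤ C232P (thetaTie q w2 w3 w4) :=
  C232P_ge_of_QPm_posSemidef _ (posSemidef_of_hermPsdCheck hcert.2
    (cmmem_of_cmatEncl hcert.1 (mem_tieBoxP hq hq3 hok w2 w3 w4 m)) (QD_conjTranspose _ _).2)

/-! ### The tie segment as a sub-class of `R`: the adapter `θ ↔ (t, ι)` (entry-adapter of record, p6) -/

/-- **`θ` lies on the tie segment of record** `ν₁ ∈ [0.5005, 0.510]`, `ν₂ = ½ = cut₁`, `ν₃ = ¾ − ν₁/2`,
printed shifts (REPAIR-LEDGER §points / row 10; `ι` free). [cite: Zhang2022LandauSiegel, §2 (2.21)–(2.26)] -/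
def OnTieSegment (θ : Theta) : Prop :=
  θ.nu2 = 1 / 2 ∧ θ.nu3 = 3 / 4 - θ.nu1 / 2 ∧ θ.k1 = 3 / 2 ∧ θ.k2 = 5 / 2 ∧ θ.k3 = 3 / 2 ∧ θ.cut1 = 1 / 2
    ∧ (0.5005 : ℝ) ≤ θ.nu1 ∧ θ.nu1 ≤ 0.510

/-- a point of the segment IS `thetaTie` at its own `(ν₁, ι)` (structure eta). [cite: Zhang2022LandauSiegel, §2 (2.21)–(2.26)] -/
theorem eq_thetaTie_of_onTie {θ : Theta} (h : OnTieSegment θ) :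
    θ = thetaTie θ.nu1 θ.iota2 θ.iota3 θ.iota4 := by
  obtain ⟨h2, h3, k1, k2, k3, hc, -, -⟩ := h
  cases θ
  simp only at h2 h3 k1 k2 k3 hc
  simp only [thetaTie, h2, h3, k1, k2, k3, hc]

/-- `thetaTie t ι` lies on the segment for `t ∈ [0.5005, 0.510]`. [cite: Zhang2022LandauSiegel, §2 (2.21)–(2.26)] -/
theorem onTie_thetaTie {t : ℝ} (h1 : (0.5005 : ℝ) ≤ t) (h2 : t ≤ 0.510) (w2 w3 w4 : ℂ) :
    OnTieSegment (thetaTie t w2 w3 w4) := by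
  refine ⟨rfl, rfl, rfl, rfl, rfl, rfl, ?_, ?_⟩ <;> simpa [thetaTie]

/-- **every point of the segment is admissible** (in CLASS `R` of record). [cite: Zhang2022LandauSiegel, §§2, 7–9, 12, 14, 15] -/
theorem admissible_of_onTie {θ : Theta} (h : OnTieSegment θ) : AdmissibleTheta θ := by
  have hlo : (1 / 2 : ℝ) < θ.nu1 := by linarith [h.2.2.2.2.2.2.1]
  have hhi : θ.nu1 < 1 := by linarith [h.2.2.2.2.2.2.2]
  rw [eq_thetaTie_of_onTie h]
  exact admissible_thetaTie hlo hhi _ _ _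

/-- **the hand-over**: a statement proved for the tie path `t ↦ thetaTie t ι` on `[0.5005, 0.510]` (p5's
1-D certified cover, `RepairTieSegment`) holds for every `θ` on the segment. [cite: Moore1966, §4.4] -/
theorem forall_onTie_of_forall_path {P : Theta → Prop}
    (h : ∀ t : ℝ, (0.5005 : ℝ) ≤ t → t ≤ 0.510 → ∀ w2 w3 w4 : ℂ, P (thetaTie t w2 w3 w4)) :
    ∀ θ, OnTieSegment θ → P θ := by
  intro θ hθ
  rw [eq_thetaTie_of_onTie hθ]
  exact h θ.nu1 hθ.2.2.2.2.2.2.1 hθ.2.2.2.2.2.2.2 _ _ _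

/-- the annex shape the rung's [Q2-9] slot consumes: a certified floor `m` of `C232D` along the path gives
`∀ θ ∈ R on the segment, m ≤ C232D θ`, hence no point of the segment meets a target `< m`.
[cite: Zhang2022LandauSiegel, (2.32), §18 p. 99] -/
theorem annex_of_path_floor {m : ℝ}
    (h : ∀ t : ℝ, (0.5005 : ℝ) ≤ t → t ≤ 0.510 → ∀ w2 w3 w4 : ℂ, m ≤ C232D (thetaTie t w2 w3 w4)) :
    ∀ θ, OnTieSegment θ → AdmissibleTheta θ ∧ m ≤ C232D θ ∧ ∀ target : ℝ, target ≤ m → ¬ (C232D θ < target) := by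
  intro θ hθ
  have hm : m ≤ C232D θ := forall_onTie_of_forall_path (P := fun θ => m ≤ C232D θ) h θ hθ
  exact ⟨admissible_of_onTie hθ, hm, fun target ht hlt => by linarith⟩

/-! ### Sanity at the printed point -/

/-- sanity at the printed point: the tie machinery reproduces p4's `C232D_thetaIota_ge`-type floor (the
width-0 regression is TEAM R's `RepairRegressionWidth0`; here only the definitional link). [cite: Zhang2022LandauSiegel, (2.26)] -/
theorem C232D_thetaTie_printed (w2 w3 w4 : ℂ) : C232D (thetaTie 0.504 w2 w3 w4) = C232cG w2 w3 w4 := by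
  rw [thetaTie_printed, C232D_thetaIota]

end Repair

end Literature.NumberTheory.LFunctions.Zhang2022
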